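import Summits.ResolutionOfSingularities.ResolutionOfSingularities.Theorems.HironakaBridgeERSGlue

/-!
# RUNG B, GAP row G8-a in the REDUCED reading: `ERSToEmbeddedSmoothResRed p` holds

Cell `res-hironaka`, LADDER-RESOLUTION rung B (OURS; no statement of any manuscript, no candidate asserted —
the typed reduced-reading candidate `HironakaERSPerfectReduced p` of `Theorems/HironakaBridge.lean` (rev. 5)
enters only as the antecedent of the `Prop` `ERSToEmbeddedSmoothResRed p`, which this file PROVES).

The proof is that of `ersToEmbeddedSmoothRes_holds` (`HironakaBridgeERSGlue.lean`): the consequence-shape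
`EmbeddedSmoothResPerfect p` only ever asks for INTEGRAL closed subschemes `i : X ↪ Z`, and `X ≅ V(ker i)` is
reduced, so the reduced-reading candidate already supplies an ERS of `V(ker i) ⊂ Z`, which is a resolution of
singularities of `X` by `hasResolution_of_isERS`. Consequences: `perfectRes_of_hironakaERSPerfectReduced`, and
the ladder in the reduced reading with the crux `DescentPerfectToAll` (stmt-ResolutionOfSingularities-0549) as
its only open hypothesis besides the candidate
(`resolutionOfSingularities_of_mainClaimPerfectReduced_of_descentPerfectToAll`, `…_iff_…`).
-/

noncomputable section

set_option linter.dupNamespace false -- mandated namespace of this single-conjunct summit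

namespace Summit.ResolutionOfSingularities.ResolutionOfSingularities.Theorems

open CategoryTheory AlgebraicGeometry
open Literature.AlgebraicGeometry.Resolution

/-- **GAP row G8-a holds in the reduced reading**: `ERSToEmbeddedSmoothResRed p` — the typed §1 candidate
for REDUCED closed subschemes of smooth irreducible quasi-compact schemes over perfect fields of characteristic
`p` (a hypothesis) implies `EmbeddedSmoothResPerfect p`; an integral `X ↪ Z` is `V(ker i)`, reduced, and an ERS
of it is a resolution (`hasResolution_of_isERS`). [folklore] -/
theorem ersToEmbeddedSmoothResRed_holds (p : ℕ) : ERSToEmbeddedSmoothResRed p := by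
  intro hH K _ _ _ Z X g i hsep hlft hqc hsm hirr hi hint
  haveI := hlft; haveI := hqc; haveI := hsm; haveI := hirr; haveI := hi; haveI := hint
  haveI : IsLocallyNoetherian Z := LocallyOfFiniteType.isLocallyNoetherian g
  haveI : Nonempty X := IrreducibleSpace.toNonempty
  haveI : Nonempty i.ker.subscheme := ⟨i.toImage (Classical.arbitrary X)⟩
  haveI : IsIntegral i.ker.subscheme := isIntegral_of_isOpenImmersion (inv i.toImage)
  obtain ⟨Z', σ, X', hE⟩ := hH K Z g i.ker inferInstance
  exact (hasResolution_of_isERS g i.ker hE).of_iso (inv i.toImage)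

/-- The reduced-reading typed candidate at `p` (hypothesis) gives resolution over every PERFECT field of
characteristic `p`. [folklore] -/
theorem perfectRes_of_hironakaERSPerfectReduced {p : ℕ} (hH : HironakaERSPerfectReduced p) : PerfectRes p :=
  b0_holds p (ersToEmbeddedSmoothResRed_holds p hH)

/-- The reduced-reading typed candidate at `p` and the `p`-slice of stmt-0549 give `ResolutionInChar p`; no
other hypothesis. [folklore] -/
theorem resolutionInChar_of_hironakaERSPerfectReduced_of_descentAt (p : ℕ) (hd : DescentAt p)
    (hH : HironakaERSPerfectReduced p) : ResolutionInChar.{0} p :=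
  resolutionInChar_of_hironakaERSPerfectReduced p (ersToEmbeddedSmoothResRed_holds p) (b0_holds p) hd hH

/-- **The ladder in the reduced reading, kernel form, with the crux as its only open hypothesis**: the TYPED
§1 candidate for reduced `X` over perfect `K` (`S01Introduction.MainClaimPerfectReduced`, a hypothesis) and
`DescentPerfectToAll` (stmt-ResolutionOfSingularities-0549) give the summit statement. [folklore] -/
theorem resolutionOfSingularities_of_mainClaimPerfectReduced_of_descentPerfectToAll
    (hH : Literature.AlgebraicGeometry.Hironaka2017.S01Introduction.MainClaimPerfectReduced.{0})
    (hd : Summit.ResolutionOfSingularities.ResolutionOfSingularities.Theses.Descent.DescentPerfectToAll) :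
    _root_.ResolutionOfSingularities :=
  _root_.ResolutionOfSingularities_iff.mpr
    (resolutionInChar_of_mainClaimPerfectReduced hH (fun p _ => ersToEmbeddedSmoothResRed_holds p)
      (fun p _ => b0_holds p) hd)

/-- GIVEN the reduced-reading typed candidate, the summit statement is EQUIVALENT to the crux stmt-0549.
[folklore] -/
theorem resolutionOfSingularities_iff_descentPerfectToAll_of_mainClaimPerfectReduced
    (hH : Literature.AlgebraicGeometry.Hironaka2017.S01Introduction.MainClaimPerfectReduced.{0}) :
    _root_.ResolutionOfSingularities ↔
      Summit.ResolutionOfSingularities.ResolutionOfSingularities.Theses.Descent.DescentPerfectToAll :=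
  ⟨fun h p hp _ => _root_.ResolutionOfSingularities_iff.mp h p hp,
    resolutionOfSingularities_of_mainClaimPerfectReduced_of_descentPerfectToAll hH⟩

end Summit.ResolutionOfSingularities.ResolutionOfSingularities.Theorems

end
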